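import Summits.ResolutionOfSingularities.ResolutionOfSingularities.Theses.Descent
import Summits.ResolutionOfSingularities.ResolutionOfSingularities.Theses.UniformComplexity
import HarnessLib

/-!
# Line `via-pac-formal-slice` for the crux `DescentPerfectToAll` (stmt-0549) — lens 4 («uniformity /
ultraproduct conditional bridge»), gen 8 (unit res-B-lens-4-g8, 2026-08-29).

[OURS · CANDIDATE] counted 0; bears_on: LADDER-RESOLUTION:B; nothing here proves resolution in char p;
rung B stays OPEN.  Paper proofs: crux workfile `PAC-TRANSFER-lens4-g8.md` (same directory).

THESIS OF THE LINE.  Existential transfer (gen 4, Theorem A: for `K ≼∃ L` and a p-basis `B` of `K`,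
`Res_K(X) ⟺ X_L` has a resolution defined over `L^p(B)`) is LOSSLESS exactly when `B` is also a p-basis of
`L`.  Two facts put every SEPARABLY CLOSED field of finite p-rank `e` in that position over a field where the
antecedent's world (a PERFECT, even algebraically closed, coefficient field) is in force up to completion:
 (T) TAYLOR EMBEDDING: a field `K` of characteristic `p` with p-basis `b₁ … b_e` embeds into
     `L := Frac(K^perf⟦z₁ … z_e⟧)` by the unique lift `φ ≡ id (mod 𝔪)`, `φ(bᵢ) = bᵢ + zᵢ`, of `K ⊂ K^perf`
     along the 0-étale extension `K/𝔽_p(b)`; `φ(B)` is a p-basis of `L` (so `L/φK` is separable and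
     `Ω_K ⊗ L ≅ Ω_L`); for `K` separably closed `K^perf = K̄`;
 (S) PAC TRANSFER: a separably closed `K` is existentially closed in every regular extension
     (Fried–Jarden 11.3.5 + 2.6.14), hence in `L`; by Theorem A with `L^p(φB) = L`,
     `Res_L(X ⊗_φ L) ⇒ Res_K(X)`.
Hence  FORMAL SLICE (resolution of reduced separated finite-type schemes over `Frac(k⟦z₁…z_e⟧)`, `k`
algebraically closed — a generic-fibre resolution problem for schemes of finite type over a complete regular
local ring over `k̄`)  ⟹  B_S,fin (resolution over every separably closed field of finite p-rank); with
SEPARABLE-CLOSURE DESCENT in finite p-rank (Galois descent of resolutions, the companion crux 0550's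
mechanism) and gen 7's conjunct `BInfty` (infinite p-rank) this decides the crux.  The countable residual
core of finite p-rank (gens 2–7) is thereby absorbed into two classical problems; no uniformity, no
ultraproduct, no Łoś.
-/

open CategoryTheory AlgebraicGeometry
open Literature.AlgebraicGeometry.Resolution

namespace Summit.ResolutionOfSingularities.ResolutionOfSingularities.Cruxes.DescentPerfectToAll.ViaPacFormalSlice

/-! ## Vocabulary (verbatim copies of gen-5/6/7 workfile definitions, which are not importable modules) -/

/-- Resolution of every reduced separated finite-type scheme over the single field `K` (gen 5, verbatim). -/
def ResOver (K : Type) [Field K] : Prop :=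
  ∀ (X : Scheme.{0}) (f : X ⟶ Spec (.of K)), IsSeparated f → LocallyOfFiniteType f →
    QuasiCompact f → IsReduced X → Scheme.HasResolution X

/-- `PerfectRes p`: the antecedent of the crux at `p` (gens 5/7, verbatim). -/
def PerfectRes (p : ℕ) : Prop :=
  ∀ (k : Type) [Field k] [CharP k p] [PerfectField k] (X : Scheme.{0}) (f : X ⟶ Spec (.of k)),
    IsSeparated f → LocallyOfFiniteType f → QuasiCompact f → IsReduced X → Scheme.HasResolution X

/-- `InfinitePRank K` (gens 6/7, verbatim): `[K : K^p] = ∞` in derivation form. -/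
def InfinitePRank (K : Type*) [CommRing K] : Prop :=
  ∀ s : Finset K, ∃ (b : K) (δ : Derivation ℤ K K), (∀ x ∈ s, δ x = 0) ∧ δ b = 1

/-- `b : Fin e → F` is a (finite) DIFFERENTIAL BASIS of the field `F`: `db₁ … db_e` is an `F`-basis of
`Ω[F/ℤ]`.  For `F` of characteristic `p` this says exactly that `b` is a p-basis of `F`
[cite: Matsumura1987, Thm. 26.5]. -/
def IsDiffBasis (F : Type) [Field F] {e : ℕ} (b : Fin e → F) : Prop :=
  LinearIndependent F (fun i => KaehlerDifferential.D ℤ F (b i)) ∧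
    Submodule.span F (Set.range fun i => KaehlerDifferential.D ℤ F (b i)) = ⊤

/-- COMMON FINITE p-BASIS: some finite p-basis of `K` maps to a p-basis of `L` (equivalently `L/K` is
separable with `Ω_K ⊗_K L ≅ Ω_L`; the hypothesis under which gen 4's Theorem A has `L^p(B) = L`). -/
def CommonPBasis (K L : Type) [Field K] [Field L] [Algebra K L] : Prop :=
  ∃ (e : ℕ) (b : Fin e → K), IsDiffBasis K b ∧ IsDiffBasis L (fun i => algebraMap K L (b i))

/-- `L` is a FORMAL FUNCTION FIELD in `e` variables over `k`: `L ≅ Frac(k⟦z₁,…,z_e⟧)`. -/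
def IsFormalFunctionField (k : Type) [Field k] (e : ℕ) (L : Type) [Field L] : Prop :=
  Nonempty (L ≃+* FractionRing (MvPowerSeries (Fin e) k))

/-! ## The five pieces -/

/-- **FORMAL SLICE over algebraically closed coefficient fields** (OPEN; the hardest stub; for `e = 1` it is
gen 5's `LaurentSliceAlgClosed`, the Disproof's typed residual hard case `LaurentSeriesCase` with `𝕜 = k̄`):
`PerfectRes p` gives resolution over every `Frac(k⟦z₁…z_e⟧)`, `k` algebraically closed of characteristic `p`.
A resolution here is the generic fibre of a regular modification of a flat finite-type `k⟦z⟧`-model, whose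
algebraic approximants are `k`-varieties of dimension `dim X + e` resolved by `PerfectRes p`. [our conjecture] -/
def FormalSliceAlgClosed (p : ℕ) : Prop :=
  PerfectRes p → ∀ (k : Type) [Field k] [CharP k p] [IsAlgClosed k] (e : ℕ) (L : Type) [Field L] [CharP L p],
    IsFormalFunctionField k e L → ResOver L

/-- **FORMAL SLICE AT THE SEPARABLE CLOSURE** (critic TRIAGE-30 Σ1, statement-level sharpening; NOT a stub of
this line): `PerfectRes p →` resolution over a separable closure `M` of a formal function field
`Frac(k⟦z₁…z_e⟧)`, `k` algebraically closed.  On paper: `FormalSliceAlgClosed p → FormalSliceSep p` (schemes of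
finite type over `M` are defined over a finite separable `L′ ⊇ L`, hence of finite type over `L`; separable
algebraic ascent of regularity), and for each `e` the `e`-part of `FormalSliceSep p` is EQUIVALENT to
`B_{S,e}(p)` = «`PerfectRes p →` resolution over every separably closed field of p-rank `e`»: (⇒) `M` is
separably closed of p-rank `e`; (⇐) for `K` separably closed of p-rank `e`, `K → L_K → M_K := L_K^sep` is
0-étale with a common p-basis and `K ≼ M_K` is even ELEMENTARY by Ershov–Wood model completeness of
`SCF_{p,e}` with the p-basis named, so Theorem A′ applies to `K ≼∃ M_K`.  Hence Cor E1 is an iff when the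
slice is taken at the separable closure. -/
def FormalSliceSep (p : ℕ) : Prop :=
  PerfectRes p → ∀ (k : Type) [Field k] [CharP k p] [IsAlgClosed k] (e : ℕ) (L : Type) [Field L] [CharP L p]
    (M : Type) [Field M] [Algebra L M] [IsSepClosure L M], IsFormalFunctionField k e L → ResOver M

/-- **TAYLOR EMBEDDING** (theorem-grade; paper proof in the memo §2): for `K` of finite p-rank, the separable
closure `K^sep` (same p-rank `e`) carries an embedding into a formal function field `L ≅ Frac(k⟦z₁…z_e⟧)` over
an algebraically closed `k` (namely `k = K̄`, `φ(bᵢ) = bᵢ + zᵢ`, the unique 0-étale lift of `K^sep ⊂ K̄`)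
under which a p-basis of `K^sep` is a p-basis of `L`. [folklore] -/
def TaylorEmbedding (p : ℕ) : Prop :=
  ∀ (K : Type) [Field K] [CharP K p], ¬ InfinitePRank K →
    ∃ (k : Type) (_ : Field k) (_ : CharP k p) (_ : IsAlgClosed k) (e : ℕ) (L : Type) (_ : Field L)
      (_ : CharP L p) (_ : Algebra (SeparableClosure K) L),
      IsFormalFunctionField k e L ∧ CommonPBasis (SeparableClosure K) L

/-- **PAC TRANSFER for separably closed fields** (theorem-grade; memo §3 = gen 4 Theorem A with `L^p(B) = L`
+ Fried–Jarden Prop. 11.3.5 / Lemma 2.6.14: a separably closed field is existentially closed in every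
separable extension): if `K` is separably closed and `L ⊇ K` shares a finite p-basis with `K`, resolution over
`L` implies resolution over `K`. [folklore] -/
def SepClosedTransfer (p : ℕ) : Prop :=
  ∀ (K L : Type) [Field K] [CharP K p] [IsSepClosed K] [Field L] [Algebra K L],
    CommonPBasis K L → ResOver L → ResOver K

/-- **B_∞(p)** (OPEN; gen 7's conjunct, verbatim shape): `PerfectRes p` gives resolution over every field of
characteristic `p` of infinite p-rank. [our conjecture] -/
def BInfty (p : ℕ) : Prop :=
  PerfectRes p → ∀ (K : Type) [Field K] [CharP K p], InfinitePRank K → ResOver K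

/-- **SEPARABLE-CLOSURE DESCENT in finite p-rank** (OPEN; the companion crux 0550's mechanism — for perfect
`K` it is `Res over K̄ ⇒ Res over K`, so a proof closes 0550 as well): resolution of everything over `K^sep`
gives resolution of everything over `K`. [our conjecture] -/
def SepClosureDescentFin (p : ℕ) : Prop :=
  ∀ (K : Type) [Field K] [CharP K p], ¬ InfinitePRank K → ResOver (SeparableClosure K) → ResOver K

/-- **B_S,fin(p)**: resolution over the separable closure of every field of finite p-rank (= over every
separably closed field of finite p-rank). Gen 3 (Theorem D, D₃) recorded «Res over K^sep is itself B_S,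
crux-grade»; this line derives its finite-p-rank part from the formal slice. [our conjecture] -/
def BSFin (p : ℕ) : Prop :=
  PerfectRes p → ∀ (K : Type) [Field K] [CharP K p], ¬ InfinitePRank K → ResOver (SeparableClosure K)

/-! ## Registered stubs -/

theorem stub_formalSliceAlgClosed : ∀ p : ℕ, p.Prime → FormalSliceAlgClosed p := by
  sorry

theorem stub_taylorEmbedding : ∀ p : ℕ, p.Prime → TaylorEmbedding p := by
  sorry

theorem stub_sepClosedTransfer : ∀ p : ℕ, p.Prime → SepClosedTransfer p := by
  sorry

theorem stub_bInfty : ∀ p : ℕ, p.Prime → BInfty p := by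
  sorry

theorem stub_sepClosureDescentFin : ∀ p : ℕ, p.Prime → SepClosureDescentFin p := by
  sorry

/-! ## Kernel-checked composition -/

/-- THE HINGE (Theorem E of the memo, as wiring): Taylor embedding + PAC transfer + formal slice ⟹ B_S,fin.
[folklore] -/
theorem bsFin_of_pieces (p : ℕ) (hT : TaylorEmbedding p) (hS : SepClosedTransfer p)
    (hF : FormalSliceAlgClosed p) : BSFin p := by
  intro hPerf K _ _ hfin
  obtain ⟨k, _, _, _, e, L, _, _, _, hL, hB⟩ := hT K hfin
  haveI : CharP (SeparableClosure K) p :=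
    charP_of_injective_algebraMap (algebraMap K (SeparableClosure K)).injective p
  exact hS (SeparableClosure K) L hB (hF hPerf k e L hL)

/-- THE SKELETON THEOREM for the register: the item's own decl `Theses.Descent.DescentPerfectToAll` from the five
DECLARED STUBS by name (sorried) — no other hypothesis.  Case split on the p-rank of the ground field:
infinite ⇒ `stub_bInfty`; finite ⇒ `bsFin_of_pieces` (Taylor embedding + PAC transfer + formal slice) gives resolution over
`K^sep`, then `stub_sepClosureDescentFin`. [folklore] -/
theorem DescentPerfectToAll_proof : Theses.Descent.DescentPerfectToAll := by
  intro p hp hPerf K _ _ X f hs hl hq hr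
  by_cases hK : InfinitePRank K
  · exact stub_bInfty p hp hPerf K hK X f hs hl hq hr
  · exact stub_sepClosureDescentFin p hp K hK
      (bsFin_of_pieces p (stub_taylorEmbedding p hp) (stub_sepClosedTransfer p hp)
        (stub_formalSliceAlgClosed p hp) hPerf K hK) X f hs hl hq hr

/-- COMPOSITION with the five stub statements as explicit hypotheses (sorry-free, same proof), for provers who close the
stubs under other names.  It concludes the rfl-equal copy `Theses.UniformComplexity.DescentPerfectToAll` of the crux (same
item stmt-0549), so that the register's skeleton theorem for `Theses.Descent.DescentPerfectToAll` is unambiguously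
`DescentPerfectToAll_proof` above. [folklore] -/
theorem UniformComplexity_DescentPerfectToAll_of
    (hF : ∀ p : ℕ, p.Prime → FormalSliceAlgClosed p)
    (hT : ∀ p : ℕ, p.Prime → TaylorEmbedding p)
    (hS : ∀ p : ℕ, p.Prime → SepClosedTransfer p)
    (hB : ∀ p : ℕ, p.Prime → BInfty p)
    (hD : ∀ p : ℕ, p.Prime → SepClosureDescentFin p) :
    Theses.UniformComplexity.DescentPerfectToAll := by
  intro p hp hPerf K _ _ X f hs hl hq hr
  by_cases hK : InfinitePRank K
  · exact hB p hp hPerf K hK X f hs hl hq hr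
  · exact hD p hp K hK (bsFin_of_pieces p (hT p hp) (hS p hp) (hF p hp) hPerf K hK) X f hs hl hq hr

/-- The two decls of the item are rfl-equal (sanity). [folklore] -/
theorem descent_eq_uniformComplexity :
    Theses.Descent.DescentPerfectToAll = Theses.UniformComplexity.DescentPerfectToAll := rfl

/-! ## Each open stub is a rung AT OR BELOW the crux (no stub is above it; none is the crux) -/

/-- The crux implies the formal slice (it is resolution over particular fields of characteristic `p`). [folklore] -/
theorem formalSliceAlgClosed_of_descentPerfectToAll (h : Theses.Descent.DescentPerfectToAll) (p : ℕ)
    (hp : p.Prime) : FormalSliceAlgClosed p := by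
  intro hPerf k _ _ _ e L _ _ _ X f hs hl hq hr
  exact h p hp hPerf L X f hs hl hq hr

/-- The crux implies `BInfty` (restriction). [folklore] -/
theorem bInfty_of_descentPerfectToAll (h : Theses.Descent.DescentPerfectToAll) (p : ℕ) (hp : p.Prime) :
    BInfty p := by
  intro hPerf K _ _ _ X f hs hl hq hr
  exact h p hp hPerf K X f hs hl hq hr

/-- The crux implies `BSFin` (restriction to separable closures). [folklore] -/
theorem bsFin_of_descentPerfectToAll (h : Theses.Descent.DescentPerfectToAll) (p : ℕ) (hp : p.Prime) :
    BSFin p := by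
  intro hPerf K _ _ _ X f hs hl hq hr
  haveI : CharP (SeparableClosure K) p :=
    charP_of_injective_algebraMap (algebraMap K (SeparableClosure K)).injective p
  exact h p hp hPerf (SeparableClosure K) X f hs hl hq hr

/-- `ResolutionInChar p` implies separable-closure descent outright (its conclusion). [folklore] -/
theorem sepClosureDescentFin_of_resolutionInChar (p : ℕ) (h : ResolutionInChar.{0} p) :
    SepClosureDescentFin p := by
  intro K _ _ _ _ X f hs hl hq hr
  exact h K X f hs hl hq hr

end Summit.ResolutionOfSingularities.ResolutionOfSingularities.Cruxes.DescentPerfectToAll.ViaPacFormalSlice
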